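import Mathlib.MeasureTheory.Measure.Lebesgue.VolumeOfBalls
import Literature.Analysis.FluidPDE.FlatSwirlGaugeChart
import HarnessLib

/-!
# The point depth: the thinness clause of the flat swirl gauge is not scale-local

The object posited by route `FlatSwirlGauge` of `NavierStokesRegularity`
(`Literature.Analysis.FluidPDE.IsFlatSwirlGaugeOn`, `IsVortexChartOn`, `HasDriftSizeDefectOn`) carries a
"depth" `d` whose sublevel sets must be thin in the sense

  `vol({d(t,·) < δ} ∩ B_ρ(x₀)) ≤ C₀ δ² ρ` for `0 < δ < ρ`,

typed ONCE, on the whole ball `B_ρ(x₀)` of the cylinder. The docstrings read this as "the degeneracy set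
`{d = 0}` is axis-like (one-dimensional)", after the exactly-flat model `d = r = cylRadius` (the thin
tube `vol({r < δ} ∩ B_ρ(x₀)) ≤ 8δ²ρ`, `volume_cylRadius_lt_inter_ball_le`). This file records, with
proofs, that the clause as typed does NOT enforce that reading:

* the ISOTROPIC **point depth** `d(x) = √(‖x − x₀‖³ / ρ) = ‖x − x₀‖^{3/2} ρ^{-1/2}` has sublevel sets
  `{d < δ} = B_{(δ²ρ)^{1/3}}(x₀)` (`setOf_pointDepth_lt_eq_ball`) of volume EXACTLY `(4π/3) δ² ρ`
  (`volume_pointDepth_lt`), so it satisfies the typed clause with the absolute constant `4π/3`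
  (`volume_pointDepth_lt_inter_ball_le`), although its degeneracy set is the single point `x₀` and
  it vanishes there to order `3/2`;
* consequently a momentum `α` whose chart nondegeneracy and drift are controlled only with the
  point weight `‖x − x₀‖^{3/2}/√ρ` — i.e. `‖curl u‖ ≤ C √ρ ‖∇α‖ / ‖x − x₀‖^{3/2}` and
  `‖b‖ ≤ C √ρ / ‖x − x₀‖^{3/2}`, bounds which are SUPERCRITICAL for Navier–Stokes at `x₀` (critical
  would be `1/‖x − x₀‖`) — IS a kinematic vortex chart / flat swirl gauge in the typed sense
  (`isVortexChartOn_pointDepth`, `hasDriftSizeDefectOn_pointDepth`, `isFlatSwirlGaugeOn_pointDepth`);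
* the point depth is dominated by the distance, `√(‖x − x₀‖³/ρ) ≤ ‖x − x₀‖` on `B_ρ(x₀)`
  (`pointDepth_le_norm_sub`), with ratio `√(‖x − x₀‖/ρ) → 0`: strictly more degenerate at `x₀` than any
  axis depth through `x₀`;
* the SCALE-LOCAL ("sub-ball") form of the clause, `vol({d < δ} ∩ B_r(x)) ≤ C₀ δ² r` for every ball
  `B_r(x) ⊆ B_ρ(x₀)` and `0 < δ < r`, excludes the point depth for EVERY constant
  (`exists_subball_volume_pointDepth_lt_gt`: at `x = x₀`, `δ = √(r³/ρ)`, the sublevel set fills `B_r(x₀)`,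
  volume `(4π/3) r³ > C δ² r = C r⁴/ρ` once `r < (4π/3) ρ / C`), while the axis depth `d = cylRadius`
  satisfies the scale-local form with constant `8` (`volume_cylRadius_lt_inter_ball_le` holds for every
  centre and radius).

These are elementary facts (Lebesgue measure of a ball in `ℝ³`, Mathlib
`EuclideanSpace.volume_ball_fin_three`); they are recorded for the planners of route `FlatSwirlGauge`,
whose refuters asked for a sub-ball-local thinness clause (items `stmt-NavierStokesRegularity-1252/1253`,
review passes 4–7, 2026-08-15), as the kernel-checked witness that the two clauses differ and that the
exactly-flat anchor survives the stronger one. No definition is introduced: the point depth is written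
out as `Real.sqrt (‖x - x₀‖ ^ 3 / ρ)` throughout. Deliberately NOT here: any statement about
Navier–Stokes solutions (whether a singular point can carry a point-degenerate gauge is the route's
business), and any restated route decl.
-/

noncomputable section

open MeasureTheory Set Function Metric Real
open scoped RealInnerProductSpace ENNReal Topology

namespace Literature.Analysis.FluidPDE

/-! ### The sublevel sets of the point depth are balls -/

section PointDepth

variable {x₀ : EuclideanSpace ℝ (Fin 3)} {ρ δ : ℝ}

/-- `√(s³/ρ) < δ ↔ s³ < δ²ρ` for `s ≥ 0`, `ρ > 0`, `δ > 0`. [folklore] -/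
theorem sqrt_cube_div_lt_iff (hρ : 0 < ρ) (hδ : 0 < δ) {s : ℝ} :
    Real.sqrt (s ^ 3 / ρ) < δ ↔ s ^ 3 < δ ^ 2 * ρ := by
  rw [Real.sqrt_lt' hδ, div_lt_iff₀ hρ]

/-- The cube of the real cube root: `((δ²ρ)^{1/3})³ = δ²ρ` (`0 ≤ δ²ρ`; real-valued twin of the
`ℝ≥0∞` lemma `rpow_third_pow_three` of `CKNMorreyBootstrapDual`). [folklore] -/
theorem real_rpow_third_pow_three (h : 0 ≤ δ ^ 2 * ρ) :
    ((δ ^ 2 * ρ) ^ (1 / 3 : ℝ)) ^ 3 = δ ^ 2 * ρ := by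
  rw [show (1 / 3 : ℝ) = ((3 : ℕ) : ℝ)⁻¹ by norm_num]
  exact Real.rpow_inv_natCast_pow h (by norm_num)

/-- **The sublevel sets of the point depth are concentric balls**:
`{x | √(‖x − x₀‖³/ρ) < δ} = B_{(δ²ρ)^{1/3}}(x₀)` for `ρ, δ > 0`. [folklore] -/
theorem setOf_pointDepth_lt_eq_ball (x₀ : EuclideanSpace ℝ (Fin 3)) (hρ : 0 < ρ) (hδ : 0 < δ) :
    {x : EuclideanSpace ℝ (Fin 3) | Real.sqrt (‖x - x₀‖ ^ 3 / ρ) < δ} =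
      ball x₀ ((δ ^ 2 * ρ) ^ (1 / 3 : ℝ)) := by
  have hpos : 0 < δ ^ 2 * ρ := by positivity
  set R : ℝ := (δ ^ 2 * ρ) ^ (1 / 3 : ℝ) with hR
  have hR0 : 0 ≤ R := Real.rpow_nonneg hpos.le _
  have hR3 : R ^ 3 = δ ^ 2 * ρ := real_rpow_third_pow_three hpos.le
  ext x
  rw [mem_setOf_eq, mem_ball, dist_eq_norm, sqrt_cube_div_lt_iff hρ hδ, ← hR3]
  exact pow_lt_pow_iff_left₀ (norm_nonneg _) hR0 (by norm_num)

/-- **Volume of the sublevel sets of the point depth**: `vol({√(‖x − x₀‖³/ρ) < δ}) = (4π/3) δ² ρ`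
exactly (`ρ, δ > 0`; Mathlib `EuclideanSpace.volume_ball_fin_three`). [folklore] -/
theorem volume_pointDepth_lt (x₀ : EuclideanSpace ℝ (Fin 3)) (hρ : 0 < ρ) (hδ : 0 < δ) :
    volume {x : EuclideanSpace ℝ (Fin 3) | Real.sqrt (‖x - x₀‖ ^ 3 / ρ) < δ} =
      ENNReal.ofReal (π * 4 / 3 * (δ ^ 2 * ρ)) := by
  have hpos : 0 < δ ^ 2 * ρ := by positivity
  rw [setOf_pointDepth_lt_eq_ball x₀ hρ hδ, EuclideanSpace.volume_ball_fin_three,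
    ← ENNReal.ofReal_pow (Real.rpow_nonneg hpos.le _), real_rpow_third_pow_three hpos.le,
    ← ENNReal.ofReal_mul hpos.le, mul_comm]

/-- **The point depth satisfies the typed thinness clause with the absolute constant `4π/3`**:
`vol({√(‖x − x₀‖³/ρ) < δ} ∩ B_ρ(x₀)) ≤ (4π/3) δ² ρ` for all `ρ, δ > 0` — although its degeneracy set is
the single point `x₀`, not an axis. [folklore] -/
theorem volume_pointDepth_lt_inter_ball_le (x₀ : EuclideanSpace ℝ (Fin 3)) (hρ : 0 < ρ)
    (hδ : 0 < δ) :
    volume ({x : EuclideanSpace ℝ (Fin 3) | Real.sqrt (‖x - x₀‖ ^ 3 / ρ) < δ} ∩ ball x₀ ρ) ≤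
      ENNReal.ofReal (π * 4 / 3 * δ ^ 2 * ρ) := by
  refine (measure_mono inter_subset_left).trans ?_
  rw [volume_pointDepth_lt x₀ hρ hδ, mul_assoc]

/-- The same bound with any constant `C ≥ 4π/3`, in the shape `C * δ ^ 2 * ρ` of the typed clause. [folklore] -/
theorem volume_pointDepth_lt_inter_ball_le_of_le (x₀ : EuclideanSpace ℝ (Fin 3)) (hρ : 0 < ρ)
    (hδ : 0 < δ) {C : ℝ} (hC : π * 4 / 3 ≤ C) :
    volume ({x : EuclideanSpace ℝ (Fin 3) | Real.sqrt (‖x - x₀‖ ^ 3 / ρ) < δ} ∩ ball x₀ ρ) ≤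
      ENNReal.ofReal (C * δ ^ 2 * ρ) := by
  refine (volume_pointDepth_lt_inter_ball_le x₀ hρ hδ).trans (ENNReal.ofReal_le_ofReal ?_)
  have : 0 ≤ δ ^ 2 * ρ := by positivity
  nlinarith

/-- The point depth is nonnegative. [folklore] -/
theorem pointDepth_nonneg (x₀ : EuclideanSpace ℝ (Fin 3)) (ρ : ℝ) (x : EuclideanSpace ℝ (Fin 3)) :
    0 ≤ Real.sqrt (‖x - x₀‖ ^ 3 / ρ) :=
  Real.sqrt_nonneg _

/-- The point depth is positive exactly off the centre (`ρ > 0`). [folklore] -/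
theorem pointDepth_pos_iff (hρ : 0 < ρ) {x : EuclideanSpace ℝ (Fin 3)} :
    0 < Real.sqrt (‖x - x₀‖ ^ 3 / ρ) ↔ x ≠ x₀ := by
  have h3 : Odd 3 := ⟨1, by norm_num⟩
  rw [Real.sqrt_pos, div_pos_iff_of_pos_right hρ, h3.pow_pos_iff, norm_pos_iff, sub_ne_zero]

/-- **The point depth lies below the distance to the centre** on `B_ρ(x₀)` (indeed on the closed ball):
`√(‖x − x₀‖³/ρ) ≤ ‖x − x₀‖`, the ratio being `√(‖x − x₀‖/ρ) ≤ 1` — so near `x₀` it is strictly more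
degenerate than any axis depth through `x₀` (`cylRadius`-type depths are comparable to the distance to the
axis). [folklore] -/
theorem pointDepth_le_norm_sub (hρ : 0 < ρ) {x : EuclideanSpace ℝ (Fin 3)} (hx : ‖x - x₀‖ ≤ ρ) :
    Real.sqrt (‖x - x₀‖ ^ 3 / ρ) ≤ ‖x - x₀‖ := by
  rw [Real.sqrt_le_left (norm_nonneg _), div_le_iff₀ hρ, pow_succ]
  exact mul_le_mul_of_nonneg_left hx (sq_nonneg _)

/-- **The scale-local (sub-ball) thinness clause excludes the point depth, for every constant.** For every
`C` there are a radius `0 < r < ρ` and `0 < δ < r` with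
`C δ² r < vol({√(‖x − x₀‖³/ρ) < δ} ∩ B_r(x₀))`: take `r ≤ ρ/C` (and `< ρ`) and `δ = √(r³/ρ)`, so that the
sublevel set contains `B_r(x₀)` (volume `(4π/3) r³`) while `C δ² r = C r⁴/ρ ≤ r³ < (4π/3) r³`. Contrast: the
axis depth satisfies the sub-ball clause with constant `8` at every centre and radius
(`volume_cylRadius_lt_inter_ball_le`). [folklore] -/
theorem exists_subball_volume_pointDepth_lt_gt (x₀ : EuclideanSpace ℝ (Fin 3)) (hρ : 0 < ρ)
    (C : ℝ) :
    ∃ r ∈ Ioo 0 ρ, ∃ δ ∈ Ioo 0 r,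
      ENNReal.ofReal (C * δ ^ 2 * r) <
        volume ({x : EuclideanSpace ℝ (Fin 3) | Real.sqrt (‖x - x₀‖ ^ 3 / ρ) < δ} ∩ ball x₀ r) := by
  -- radius: `r = min (ρ/2) (ρ / max C 1)`, so `0 < r < ρ` and `C r ≤ ρ`
  set K : ℝ := max C 1 with hK
  have hK1 : 1 ≤ K := le_max_right _ _
  have hK0 : 0 < K := one_pos.trans_le hK1
  set r : ℝ := min (ρ / 2) (ρ / K) with hr
  have hr0 : 0 < r := lt_min (by positivity) (div_pos hρ hK0)
  have hrρ : r < ρ := (min_le_left _ _).trans_lt (by linarith)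
  have hrK : K * r ≤ ρ := by
    have : r ≤ ρ / K := min_le_right _ _
    rwa [le_div_iff₀ hK0, mul_comm] at this
  have hCr : C * r ≤ ρ := (mul_le_mul_of_nonneg_right (le_max_left C 1) hr0.le).trans hrK
  -- depth level: `δ = √(r³/ρ)`, so `δ² ρ = r³` and `δ < r`
  set δ : ℝ := Real.sqrt (r ^ 3 / ρ) with hδ
  have hδ0 : 0 < δ := Real.sqrt_pos.2 (by positivity)
  have hδ2 : δ ^ 2 = r ^ 3 / ρ := Real.sq_sqrt (by positivity)
  have hδr : δ < r := by
    rw [hδ, Real.sqrt_lt' hr0, div_lt_iff₀ hρ, pow_succ]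
    exact mul_lt_mul_of_pos_left hrρ (by positivity)
  refine ⟨r, ⟨hr0, hrρ⟩, δ, ⟨hδ0, hδr⟩, ?_⟩
  -- the sublevel set contains the whole ball `B_r(x₀)`
  have hsub : ball x₀ r ⊆
      {x : EuclideanSpace ℝ (Fin 3) | Real.sqrt (‖x - x₀‖ ^ 3 / ρ) < δ} ∩ ball x₀ r := by
    intro x hx
    refine ⟨?_, hx⟩
    rw [mem_ball, dist_eq_norm] at hx
    rw [mem_setOf_eq, sqrt_cube_div_lt_iff hρ hδ0, hδ2, div_mul_cancel₀ _ hρ.ne']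
    exact pow_lt_pow_left₀ hx (norm_nonneg _) (by norm_num)
  refine lt_of_lt_of_le ?_ (measure_mono hsub)
  rw [EuclideanSpace.volume_ball_fin_three, ← ENNReal.ofReal_pow hr0.le,
    ← ENNReal.ofReal_mul (by positivity), ENNReal.ofReal_lt_ofReal_iff (by positivity), hδ2]
  -- `C (r³/ρ) r ≤ r³ < (4π/3) r³`
  have hr3 : 0 < r ^ 3 := by positivity
  have h1 : C * (r ^ 3 / ρ) * r = r ^ 3 * (C * r / ρ) := by ring
  have h2 : C * r / ρ ≤ 1 := by rwa [div_le_one hρ]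
  have hπ : (1 : ℝ) < π * 4 / 3 := by nlinarith [Real.two_le_pi]
  calc C * (r ^ 3 / ρ) * r = r ^ 3 * (C * r / ρ) := h1
    _ ≤ r ^ 3 * 1 := mul_le_mul_of_nonneg_left h2 hr3.le
    _ < r ^ 3 * (π * 4 / 3) := mul_lt_mul_of_pos_left hπ hr3

end PointDepth

/-! ### Point-degenerate charts and gauges are charts and gauges in the typed sense -/

section Chart

variable {ν T ρ C M : ℝ} {u : ℝ → EuclideanSpace ℝ (Fin 3) → EuclideanSpace ℝ (Fin 3)}
  {x₀ : EuclideanSpace ℝ (Fin 3)} {α : ℝ → EuclideanSpace ℝ (Fin 3) → ℝ}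
  {b : ℝ → EuclideanSpace ℝ (Fin 3) → EuclideanSpace ℝ (Fin 3)}

/-- **Point-degenerate kinematic vortex charts.** If `0 < ρ`, `ρ² < T`, `α ∈ C²(Q_ρ(T, x₀))`, `|α| ≤ M`,
`⟪curl u, ∇α⟫ = 0` on the cylinder, `4π/3 ≤ C`, and the vorticity is dominated by the gradient of `α` only
with the POINT weight, `‖curl u(t,x)‖ √(‖x − x₀‖³/ρ) ≤ C ‖∇α(t,x)‖` (i.e. `‖ω‖ ≤ C √ρ ‖∇α‖ / ‖x − x₀‖^{3/2}`,
a bound supercritical at `x₀`), then `(α, d)` with the point depth `d(t, x) = √(‖x − x₀‖³/ρ)` is a kinematic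
vortex chart on `Q_ρ(T, x₀)` with constants `C, M` in the sense of `IsVortexChartOn`. [folklore] -/
theorem isVortexChartOn_pointDepth (hρ : 0 < ρ) (hρT : ρ ^ 2 < T)
    (hcd : ContDiffOn ℝ 2 (uncurry α) (Ioo (T - ρ ^ 2) T ×ˢ ball x₀ ρ))
    (hM : ∀ t ∈ Ioo (T - ρ ^ 2) T, ∀ x ∈ ball x₀ ρ, |α t x| ≤ M)
    (hfirst : ∀ t ∈ Ioo (T - ρ ^ 2) T, ∀ x ∈ ball x₀ ρ, ⟪curl (u t) x, gradient (α t) x⟫ = 0)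
    (hC : π * 4 / 3 ≤ C)
    (hω : ∀ t ∈ Ioo (T - ρ ^ 2) T, ∀ x ∈ ball x₀ ρ,
      ‖curl (u t) x‖ * Real.sqrt (‖x - x₀‖ ^ 3 / ρ) ≤ C * ‖gradient (α t) x‖) :
    IsVortexChartOn u T x₀ ρ C M α (fun _ x => Real.sqrt (‖x - x₀‖ ^ 3 / ρ)) :=
  ⟨hρ, hρT, hcd, fun _ _ _ hδ => volume_pointDepth_lt_inter_ball_le_of_le x₀ hρ hδ.1 hC,
    fun t ht x hx => ⟨hM t ht x hx, hfirst t ht x hx, fun _ => hω t ht x hx⟩⟩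

/-- **Point-degenerate drift-size defect.** If off the centre the transport defect
`f = ∂ₜα + (u·∇)α − νΔα` obeys only the point-weighted bound `|f(t,x)| √(‖x − x₀‖³/ρ) ≤ ν C₁ ‖∇α(t,x)‖`
(i.e. `|f| ≤ ν C₁ √ρ ‖∇α‖ / ‖x − x₀‖^{3/2}`), then `α` has drift-size defect with the point depth in the
sense of `HasDriftSizeDefectOn`. [folklore] -/
theorem hasDriftSizeDefectOn_pointDepth {C₁ : ℝ}
    (hf : ∀ t ∈ Ioo (T - ρ ^ 2) T, ∀ x ∈ ball x₀ ρ, x ≠ x₀ →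
      |transportDefect ν u α t x| * Real.sqrt (‖x - x₀‖ ^ 3 / ρ) ≤ ν * C₁ * ‖gradient (α t) x‖)
    (hρ : 0 < ρ) :
    HasDriftSizeDefectOn ν u T x₀ ρ C₁ α (fun _ x => Real.sqrt (‖x - x₀‖ ^ 3 / ρ)) :=
  fun t ht x hx hd => hf t ht x hx ((pointDepth_pos_iff hρ).1 hd)

/-- **Point-degenerate flat swirl gauges.** If `0 < ρ`, `ρ² < T`, `α ∈ C²(Q_ρ(T, x₀))`, `|α| ≤ M`,
`⟪curl u, ∇α⟫ = 0` on the cylinder, `4π/3 ≤ C`, and OFF THE CENTRE `x ≠ x₀` the three drift clauses hold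
with the point weight only — `‖curl u‖ √(‖x − x₀‖³/ρ) ≤ C ‖∇α‖`, `‖b‖ √(‖x − x₀‖³/ρ) ≤ C` (i.e.
`‖b‖ ≤ C √ρ / ‖x − x₀‖^{3/2}`, supercritical at `x₀`) and `∂ₜα + (u·∇)α = ν(Δα + ⟪b, ∇α⟫)` — then
`(α, b, d)` with the point depth `d(t,x) = √(‖x − x₀‖³/ρ)` is a flat swirl gauge on `Q_ρ(T, x₀)` with
constants `C, M` in the typed sense `IsFlatSwirlGaugeOn`: the typed thinness clause does not see that the
degeneracy is concentrated at a point rather than along an axis. [folklore] -/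
theorem isFlatSwirlGaugeOn_pointDepth (hρ : 0 < ρ) (hρT : ρ ^ 2 < T)
    (hcd : ContDiffOn ℝ 2 (uncurry α) (Ioo (T - ρ ^ 2) T ×ˢ ball x₀ ρ))
    (hM : ∀ t ∈ Ioo (T - ρ ^ 2) T, ∀ x ∈ ball x₀ ρ, |α t x| ≤ M)
    (hfirst : ∀ t ∈ Ioo (T - ρ ^ 2) T, ∀ x ∈ ball x₀ ρ, ⟪curl (u t) x, gradient (α t) x⟫ = 0)
    (hC : π * 4 / 3 ≤ C)
    (hpt : ∀ t ∈ Ioo (T - ρ ^ 2) T, ∀ x ∈ ball x₀ ρ, x ≠ x₀ →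
      ‖curl (u t) x‖ * Real.sqrt (‖x - x₀‖ ^ 3 / ρ) ≤ C * ‖gradient (α t) x‖ ∧
        ‖b t x‖ * Real.sqrt (‖x - x₀‖ ^ 3 / ρ) ≤ C ∧
        deriv (fun s => α s x) t + convect (u t) (α t) x =
          ν * (Laplacian.laplacian (α t) x + ⟪b t x, gradient (α t) x⟫)) :
    IsFlatSwirlGaugeOn ν u T x₀ ρ C M α b (fun _ x => Real.sqrt (‖x - x₀‖ ^ 3 / ρ)) :=
  ⟨hρ, hρT, hcd, fun _ _ _ hδ => volume_pointDepth_lt_inter_ball_le_of_le x₀ hρ hδ.1 hC,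
    fun t ht x hx => ⟨hM t ht x hx, hfirst t ht x hx,
      fun hd => hpt t ht x hx ((pointDepth_pos_iff hρ).1 hd)⟩⟩

/-- **Hence `HasFlatSwirlGauge` from point-weighted data** (corollary, constant `max C (4π/3)`): the
existence statement concluded by the route's crux `FlatGaugeAtSingularity` is already witnessed by a
bounded `C²` first integral `α` of the vorticity and a drift `b` with `‖curl u‖ ‖x − x₀‖^{3/2} ≤ C√ρ‖∇α‖`,
`‖b‖ ‖x − x₀‖^{3/2} ≤ C√ρ` and the transport law off the centre — no axis and no one-dimensional
degeneracy set is required by the typed statement. [folklore] -/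
theorem hasFlatSwirlGauge_of_pointWeighted (hρ : 0 < ρ) (hρT : ρ ^ 2 < T)
    (hcd : ContDiffOn ℝ 2 (uncurry α) (Ioo (T - ρ ^ 2) T ×ˢ ball x₀ ρ))
    (hM : ∀ t ∈ Ioo (T - ρ ^ 2) T, ∀ x ∈ ball x₀ ρ, |α t x| ≤ M)
    (hfirst : ∀ t ∈ Ioo (T - ρ ^ 2) T, ∀ x ∈ ball x₀ ρ, ⟪curl (u t) x, gradient (α t) x⟫ = 0)
    (hpt : ∀ t ∈ Ioo (T - ρ ^ 2) T, ∀ x ∈ ball x₀ ρ, x ≠ x₀ →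
      ‖curl (u t) x‖ * Real.sqrt (‖x - x₀‖ ^ 3 / ρ) ≤ C * ‖gradient (α t) x‖ ∧
        ‖b t x‖ * Real.sqrt (‖x - x₀‖ ^ 3 / ρ) ≤ C ∧
        deriv (fun s => α s x) t + convect (u t) (α t) x =
          ν * (Laplacian.laplacian (α t) x + ⟪b t x, gradient (α t) x⟫)) :
    HasFlatSwirlGauge ν u T x₀ := by
  refine (isFlatSwirlGaugeOn_pointDepth (b := b) (C := max C (π * 4 / 3)) hρ hρT hcd hM hfirst
    (le_max_right _ _) fun t ht x hx hne => ?_).hasFlatSwirlGauge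
  obtain ⟨h1, h2, h3⟩ := hpt t ht x hx hne
  exact ⟨h1.trans (mul_le_mul_of_nonneg_right (le_max_left _ _) (norm_nonneg _)),
    h2.trans (le_max_left _ _), h3⟩

end Chart

end Literature.Analysis.FluidPDE

end
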